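import Summits.BirchSwinnertonDyer.BirchSwinnertonDyer.Theorems.Rank1ResidualX11RankOneReduction
import HarnessLib

/-!
# BSD rank-≤1 residual cell, class X11 ∧ r = 1 ∧ ¬sst ∧ p ≥ 5: `BSD(E,p)` for the 85 residue pairs
# from the ten published facts and the CORE claims only (r_an = 1, #Ш_an = 1, the p-adic identity;
# surjectivity for the 11 (ram)-free pairs) — every finite hypothesis now a kernel theorem

HONEST FRAMING (cell `b2b-bsdres-*`, verbatim): prove what is provable now; shrink each hard class
to its core with data; no claim beyond stated classes; COMBINATION classes deleted from PUBLISHED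
theorems only, CONSTRUCTION-shaped remainder typed; this is not "finishing BSD". Class X11b stays
CONSTRUCTION-SHAPED; everything here is PER PAIR; no lane verdict is changed; no named fact.

Theorems only. The gen-0 headline (`bsdp_of_certified_of_claims_of_published`, and gen 2's
instance-free `X11RankOne.bsdp_of_published_of_claims`) reads: ten published named facts + the 85
records' `Claim`s ⟹ `BSD(E,p)`. After `Rank1ResidualX11RankOneReduction.lean` the conjuncts `Mult`,
split type, `¬ Semistable`, (ram), `Irr` of `Claim` are kernel theorems, so the hypothesis per pair
shrinks to the CORE CLAIM (spelled inline, no new definition):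
`r.curve.analyticRank = 1 ∧ (r.ram = [] → Surj r.curve r.p) ∧ shaAn r.curve = r.shaAn ∧
(split → r.CertSplit) ∧ (non-split → r.CertNonsplit)` — analytic rank one, `#Ш_an = 1`, the
two-engine `p`-adic valuation identity, and surjectivity of `ρ̄_{E,p}` ONLY for the 11 records without
a (ram) witness (`ram_nil_exactly`; the other 74 go through Skinner 2016 Thm. A, whose hypotheses
(irr) + (ram) are now kernel facts, so their Serre witnesses are no longer load-bearing).

* `bsdp_core_of_split_of_ram` / `bsdp_core_of_nonsplit_of_ram` — the Skinner-A route
  with explicit core hypotheses (x11a's `Typed.X11.bsdp_of_thmA_{split,nonsplit}_of_certificate`,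
  bookkeeping instantiated from tree theorems exactly as in `Claim.lean`; the MTT non-split
  `p`-adic `L`-function from the tree THEOREM `exists_isMultPAdicLFunctionOf_neg_one_holds`);
* `claim_of_core` — the full `Claim` from the core claim plus the kernel facts (for the
  Kato–Wuthrich surjective route of the 11);
* `bsdp_of_published_of_coreClaims` — HEADLINE: the ten published named facts + the 85 core claims
  ⟹ `BSDp r.curve r.p` for every record, dispatching on `r.ram` ((ram) first) and `r.split`; no
  instance hypothesis.

References: Skinner 2016 Thm. A [Skinner2016PacificMC]; Stein–Wuthrich 2013 Thm. 6.1, §4.2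
[SteinWuthrich2013]; Wuthrich 2014 Thm. 3, Cor. 19, Prop. 21 [Wuthrich2014]; Mazur–Tate–Teitelbaum
1986 §I.10–I.14, §II.10 [MazurTateTeitelbaum1986Invent]; Mazur 1978 Prop. 6.3 (1) [Mazur1978];
Silverman *AEC* VII.5.1 [SilvermanAEC2009]; Cremona's tables [Cremona2006].
-/

set_option linter.dupNamespace false
set_option autoImplicit false

noncomputable section

open scoped Classical MatrixGroups ModularForm

open CongruenceSubgroup WeierstrassCurve Literature.NumberTheory.EllipticCurves
  Literature.NumberTheory.EllipticCurves.ModularForms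
  Literature.NumberTheory.EllipticCurves.Rank1Residual
  Literature.NumberTheory.EllipticCurves.Rank1Residual.Typed
  Literature.NumberTheory.EllipticCurves.Skinner2016
  Literature.NumberTheory.EllipticCurves.Wuthrich2014
  Literature.NumberTheory.EllipticCurves.SteinWuthrich2013
  Literature.NumberTheory.EllipticCurves.Rank1Residual.X11RankOneCertificates

namespace Summit.BirchSwinnertonDyer.BirchSwinnertonDyer.Rank1Residual.X11RankOne

/-- **Exactly 11 of the 85 records have no (ram) witness** (kernel-evaluated): `8085y1`, `8670u1`,
`10890cc1`, `12705q1`, `13230dt1`, `14560d1`, `15390r1`, `16905bb1`, `17955m1`, `18360a1`, `19170s1`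
(= x11a's "¬sst ∧ ¬ram" eleven; route F35, surjectivity needed); the other 74 go through Skinner
2016 Thm. A with (irr) and (ram) kernel-certified. [folklore] -/
theorem ram_nil_exactly :
    ((records1 ++ records2).filter fun r => r.ram.isEmpty).map Record.label =
      ["8085y1", "8670u1", "10890cc1", "12705q1", "13230dt1", "14560d1", "15390r1", "16905bb1", "17955m1", "18360a1", "19170s1"] := by
  decide

section Consumers

variable (r : Record) [Fact r.p.Prime] [r.curve.IsElliptic] [r.curve.IsGloballyMinimal]

/-- **Skinner-A route, split, CORE hypotheses only**: for a record (of the 85) with a (ram) witness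
and `split = true`, the published facts Skinner 2016 Thm. A `hA`, Stein–Wuthrich Thm. 6.1 `hJ`,
SW §4.2 height existence `hH`, Wuthrich Prop. 21 `hW`, GZK, modularity `hmod`/`hpar`, together with
analytic rank `1`, `#Ш_an` as recorded and the `p`-adic certificate `CertSplit`, give `BSD(E,p)`;
`Mult`, `Irr`, `¬sst`, `Ram`, the split type are the kernel theorems of `reduction_of_mem`.
[cite: Skinner2016PacificMC, Thm. A] [cite: SteinWuthrich2013, Thm. 6.1 (p. 20) and §4.2] -/
theorem bsdp_core_of_split_of_ram (hr : r ∈ records1 ++ records2)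
    (hA : thmA_charIdeal_multiplicative) (hJ : thm61_splitMultiplicative)
    (hH : exists_isSplitMultCanonical) (hW : Wuthrich2014.sha_dvd_analyticSha)
    (hGZK : rank_eq_analyticRank_of_analyticRank_le_one) (hmod : hasEntireLFunction_rat)
    (hpar : nonempty_modularParametrizationData)
    (hsplit : r.split = true) (hramne : r.ram ≠ []) (hran : r.curve.analyticRank = 1)
    (hsha : Literature.NumberTheory.EllipticCurves.shaAn r.curve = ((r.shaAn : ℚ) : ℂ))
    (hcs : r.CertSplit) : BSDp r.curve r.p := by
  have hc : r.check = true := certified_all.check_of_mem hr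
  obtain ⟨hmult, hsp, -, hnsst, hram, hirr⟩ := reduction_of_mem r hr
  have hp5 : 5 ≤ r.p := r.five_le_of_check hc
  have hX : ClassX11 r.curve r.p := ⟨hmult, hirr, Or.inr (Or.inl ⟨hran, hnsst⟩)⟩
  have hsplit' := hsp hsplit
  obtain ⟨κ, hκ, γ, hγ, hγ'⟩ := exists_isCyclotomic_isTopGenerator_isCyclotomicVariable_holds r.p
  obtain ⟨D⟩ := r.curve.nonempty_selmerDualData_holds κ γ hγ
  haveI : NeZero (r.curve.conductorNorm ℤ) := ⟨(r.curve.conductorNorm_pos_holds).ne'⟩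
  obtain ⟨Dm⟩ := hpar r.curve
  obtain ⟨ϖ, hϖpos, hϖ, -⟩ := Dm.exists_rat_mul_realPeriodRat_eq_plusPeriod
  obtain ⟨L, hL⟩ := exists_isSplitMultPAdicLFunctionOf hsplit' Dm.isNewformOf
  obtain ⟨Dq⟩ := (nonempty_tateParameterData_iff_holds (W := r.curve) (p := r.p)).mpr hsplit'
  have hrank : r.curve.mordellWeilRank = 1 := by rw [(hGZK r.curve (le_of_eq hran)).1, hran]
  obtain ⟨hordL, hcert⟩ := hcs Dm.f ϖ L Dm.isNewformOf hϖ hL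
  exact X11.bsdp_of_thmA_split_of_certificate hA hJ hH hW hGZK hmod r.curve r.p LInvariant_ne_zero_holds
    (by omega) (le_of_eq hran) hX (hram hramne) Dq hκ hγ hγ' Dm.isNewformOf D ϖ hϖpos.ne' hϖ L hL
    (by rw [hrank]; exact hordL) (fun Dh hDh => by rw [hrank]; exact hcert Dq Dh hDh) hsha
    (r.padicValRat_shaAn_eq_zero hc)

/-- **Skinner-A route, non-split, CORE hypotheses only** (the `p`-adic `L`-function at the non-split
prime from the tree theorem `exists_isMultPAdicLFunctionOf_neg_one_holds`, MTT 1986).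
[cite: Skinner2016PacificMC, Thm. A] [cite: SteinWuthrich2013, Thm. 6.1 (p. 20), §3.1 (p. 9), §4.2]
[cite: MazurTateTeitelbaum1986Invent, §I.10–I.14] -/
theorem bsdp_core_of_nonsplit_of_ram (hr : r ∈ records1 ++ records2)
    (hA : thmA_charIdeal_multiplicative) (hJ : thm61_nonsplitMultiplicative)
    (hH : exists_isMultCanonical) (hW : Wuthrich2014.sha_dvd_analyticSha)
    (hGZK : rank_eq_analyticRank_of_analyticRank_le_one) (hmod : hasEntireLFunction_rat)
    (hpar : nonempty_modularParametrizationData)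
    (hsplit : r.split = false) (hramne : r.ram ≠ []) (hran : r.curve.analyticRank = 1)
    (hsha : Literature.NumberTheory.EllipticCurves.shaAn r.curve = ((r.shaAn : ℚ) : ℂ))
    (hcn : r.CertNonsplit) : BSDp r.curve r.p := by
  have hc : r.check = true := certified_all.check_of_mem hr
  obtain ⟨hmult, -, hnsp, hnsst, hram, hirr⟩ := reduction_of_mem r hr
  have hp5 : 5 ≤ r.p := r.five_le_of_check hc
  have hX : ClassX11 r.curve r.p := ⟨hmult, hirr, Or.inr (Or.inl ⟨hran, hnsst⟩)⟩
  have hns := hnsp hsplit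
  obtain ⟨κ, hκ, γ, hγ, hγ'⟩ := exists_isCyclotomic_isTopGenerator_isCyclotomicVariable_holds r.p
  obtain ⟨D⟩ := r.curve.nonempty_selmerDualData_holds κ γ hγ
  haveI : NeZero (r.curve.conductorNorm ℤ) := ⟨(r.curve.conductorNorm_pos_holds).ne'⟩
  obtain ⟨Dm⟩ := hpar r.curve
  obtain ⟨ϖ, hϖpos, hϖ, -⟩ := Dm.exists_rat_mul_realPeriodRat_eq_plusPeriod
  obtain ⟨L, hL⟩ := exists_isMultPAdicLFunctionOf_neg_one_holds r.curve r.p Dm.f hmult hns Dm.isNewformOf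
  obtain ⟨q, ⟨hq0, hq1, hqj⟩, -⟩ := existsUnique_tateJ_eq_of_one_lt_norm
    (one_lt_norm_j_of_hasMultiplicativeReductionAtPrime (W := r.curve) (p := r.p) hmult)
  have hrank : r.curve.mordellWeilRank = 1 := by rw [(hGZK r.curve (le_of_eq hran)).1, hran]
  obtain ⟨hordL, hcert⟩ := hcn Dm.f ϖ L Dm.isNewformOf hϖ hL
  exact X11.bsdp_of_thmA_nonsplit_of_certificate hA hJ hH hW hGZK hmod r.curve r.p (by omega)
    (le_of_eq hran) hX (hram hramne) hns hq0 hq1 hqj hκ hγ hγ' Dm.isNewformOf D ϖ hϖpos.ne' hϖ L hL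
    (by rw [hrank]; exact hordL)
    (fun Dh hDh => by rw [hrank, pow_one]; simpa using hcert q hq0 hq1 hqj Dh hDh) hsha
    (r.padicValRat_shaAn_eq_zero hc)

end Consumers

/-- **The full `Claim` of a record from its CORE claim** (analytic rank, surjectivity if witnessed,
`#Ш_an`, the `p`-adic certificate) — `Mult`, `Irr`, `¬sst`, `Ram`, split type supplied by the kernel
(`reduction_of_mem`). [folklore] -/
theorem claim_of_core (r : Record) (hr : r ∈ records1 ++ records2)
    (h : ∀ [Fact r.p.Prime] [r.curve.IsElliptic] [r.curve.IsGloballyMinimal],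
      r.curve.analyticRank = 1 ∧ (r.serre ≠ [] → Surj r.curve r.p) ∧
      Literature.NumberTheory.EllipticCurves.shaAn r.curve = ((r.shaAn : ℚ) : ℂ) ∧
      (r.split = true → r.CertSplit) ∧ (r.split = false → r.CertNonsplit)) : r.Claim := by
  intro _ _ _
  obtain ⟨hran, hsurj, hsha, hcs, hcn⟩ := h
  obtain ⟨hmult, hsp, hnsp, hnsst, hram, hirr⟩ := reduction_of_mem r hr
  exact ⟨hran, hmult, hirr, hnsst, hsurj, hram, hsp, hnsp, hsha, hcs, hcn⟩

/-- **HEADLINE — `BSD(E,p)` for all 85 residue pairs of X11 ∧ r = 1 ∧ ¬sst ∧ p ≥ 5 (N < 2·10⁴) from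
the TEN published named facts and the CORE claims alone.** Hypotheses: Kato–Wuthrich surjective
divisibility `hK` (used only for the 11 (ram)-free records), Skinner 2016 Thm. A `hA`, Stein–Wuthrich
2013 Thm. 6.1 split/non-split `hJs`/`hJn`, SW §4.2 height existence `hHs`/`hHn`, Wuthrich 2014
Prop. 21 `hW`, Gross–Zagier–Kolyvagin `hGZK`, modularity `hmod`/`hpar`; and per record the core claim
(analytic rank `1`; `Surj` only if `ram = []`; `#Ш_an` as recorded (`= 1`); the `p`-adic certificate).
Everything else about the 85 curves — primality, non-singularity, global minimality, multiplicative
reduction at `p`, split type, an additive prime, the (ram) witness, irreducibility of `E[p]` — is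
verified by the kernel. Per pair; the class label is unchanged.
[cite: Skinner2016PacificMC, Thm. A] [cite: SteinWuthrich2013, Thm. 6.1 (p. 20) and §4.2]
[cite: Wuthrich2014, Thm. 3 (p. 383), Cor. 19 (p. 398), Prop. 21 (p. 400)] [cite: Mazur1978, §6 Prop. 6.3 (1) (p. 153)] -/
theorem bsdp_of_published_of_coreClaims
    (hK : kato_charIdeal_dvd_multiplicative_of_surjective) (hA : thmA_charIdeal_multiplicative)
    (hJs : thm61_splitMultiplicative) (hJn : thm61_nonsplitMultiplicative)
    (hHs : exists_isSplitMultCanonical) (hHn : exists_isMultCanonical)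
    (hW : Wuthrich2014.sha_dvd_analyticSha) (hGZK : rank_eq_analyticRank_of_analyticRank_le_one)
    (hmod : hasEntireLFunction_rat) (hpar : nonempty_modularParametrizationData)
    (hcore : ∀ r ∈ records1 ++ records2,
      ∀ [Fact r.p.Prime] [r.curve.IsElliptic] [r.curve.IsGloballyMinimal],
        r.curve.analyticRank = 1 ∧ (r.ram = [] → Surj r.curve r.p) ∧
        Literature.NumberTheory.EllipticCurves.shaAn r.curve = ((r.shaAn : ℚ) : ℂ) ∧
        (r.split = true → r.CertSplit) ∧ (r.split = false → r.CertNonsplit))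
    (r : Record) (hr : r ∈ records1 ++ records2) : BSDp r.curve r.p := by
  have hc : r.check = true := certified_all.check_of_mem hr
  haveI : Fact r.p.Prime := ⟨r.prime_of_check hc⟩
  haveI : r.curve.IsElliptic := r.isElliptic_of_check hc
  haveI : r.curve.IsGloballyMinimal := isGloballyMinimal_curve_of_mem r hr
  obtain ⟨hran, hsurj, hsha, hcs, hcn⟩ := hcore r hr
  by_cases hramne : r.ram ≠ []
  · cases hs : r.split
    · exact bsdp_core_of_nonsplit_of_ram r hr hA hJn hHn hW hGZK hmod hpar hs hramne hran hsha (hcn hs)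
    · exact bsdp_core_of_split_of_ram r hr hA hJs hHs hW hGZK hmod hpar hs hramne hran hsha (hcs hs)
  · have hramnil : r.ram = [] := by simpa using hramne
    have hclaim : r.Claim := claim_of_core r hr ⟨hran, fun _ ↦ hsurj hramnil, hsha, hcs, hcn⟩
    exact r.bsdp_of_claim' (inputs_of_published hK hA hJs hJn hHs hHn hW hGZK hmod hpar) hc hclaim

end Summit.BirchSwinnertonDyer.BirchSwinnertonDyer.Rank1Residual.X11RankOne

end
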